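import Summits.ResolutionOfSingularities.ResolutionOfSingularities.Theorems.DescentDescentPerfectToAllFgModel
import Summits.ResolutionOfSingularities.ResolutionOfSingularities.Theorems.DescentDescentPerfectToAllRobustSeparable
import Summits.ResolutionOfSingularities.ResolutionOfSingularities.Theorems.DescentDescentPerfectToAllFiniteLevels
import Summits.ResolutionOfSingularities.ResolutionOfSingularities.Theorems.DescentDescentPerfectToAllRobustModel
import Summits.ResolutionOfSingularities.ResolutionOfSingularities.Theorems.DescentDescentPerfectToAllSeparablyGenerated
import Summits.ResolutionOfSingularities.ResolutionOfSingularities.Theorems.DescentDescentPerfectToAllResolvableFields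
import Summits.ResolutionOfSingularities.ResolutionOfSingularities.Theorems.DescentDescentPerfectToAllCountableReduction
import HarnessLib

/-!
# [OURS · L1 W8.2] THE REACH OF THE PRIME FIELD: resolution over the finitely generated subfields of a field `k`
# gives resolution over `k` as soon as `k` is separably exhausted by them — every field with a separating
# transcendence basis over `𝔽_p` (any transcendence degree) is reached; the question is decided on countable fields

Cell `res-hironaka` (run/shared/lean/pub/res-hironaka/), LADDER-RESOLUTION rung L (RESCUE), slot W8.2; host route
`UniversalCells`, host item `PrimeFieldToPerfect` (stmt-ResolutionOfSingularities-15233), door 1 («the prime field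
suffices»). Proofs file (Theses-free), written by res-L1-s82-pv-1 (gen 5). The PrimeFieldRes-antecedent forms and the
by-name links to the crux live in the sibling leaf `…PrimeFieldReachLinks.lean`; the negative side (which fields are
NOT reached) in `…PrimeFieldReachNegative.lean`.

Door 1's half (a) («𝔽_p ⇒ finitely generated fields», spreading out + generic fibre; in the tree as
`Theorems.fgLevelRes_of_primeFieldRes`, rung B1) is a theorem; half (b) («finitely generated ⇒ perfect») is the open
residual. This file records, by name and sorry-free, HOW FAR the half-(a) mechanism reaches when it is combined with
the one operation under which existence-only resolutions are known to travel — ASCENT ALONG A SEPARABLE EXTENSION OF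
THE GROUND FIELD (Mac Lane; route `Descent`'s `hasResolution_pullback_subtype_of_linearIndepOn_pow`, EGA IV₂ 6.7.4):

* `hasResolution_of_fgLevelRes_of_separablyExhausted` — **REACH.** If every reduced separated scheme of finite type
  over every FINITELY GENERATED subfield `L = closure t ⊆ k` has a resolution, then so does every reduced separated
  scheme of finite type over `k`, provided `k` is *separably exhausted by finitely generated subfields*: every finite
  subset of `k` lies in a finitely generated `L` over which `k` is separable in Mac Lane's sense (`L`-linearly
  independent finite families of `k` have `L`-linearly independent `p`-th powers). (The proof is that of route
  `Descent`'s `hasResolution_of_perfectRes_of_separablyExhausted`, whose perfect-field antecedent served only to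
  resolve the finitely generated levels; here that level resolution IS the hypothesis.)
* `separablyExhausted_of_separatingTranscendenceBasis_bot` — **every field with a SEPARATING TRANSCENDENCE BASIS OVER
  THE PRIME FIELD is so exhausted** (Mac Lane 1939): `B ⊆ k` with `p`-independent finite subfamilies and `k`
  separable algebraic over `𝔽_p(B)`; the levels are the finitely generated fields `𝔽_p(T)(s)`, `T ⊆ B` finite.
  Hence `hasResolution_of_fgLevelRes_of_separatingTranscendenceBasis_bot` (e.g. `k = 𝔽_p(x_σ)` for ANY set of
  variables `σ`, `k = 𝔽̄_p(x_σ)`, `k = 𝔽_p(x_σ)^{sep}`), and `hasResolution_of_fgLevelRes_of_isSeparable_fg`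
  (separable algebraic over a finitely generated subfield).
* `hasResolution_of_countableLevels` — **COUNTABLE GROUND FIELDS DECIDE**: if every reduced separated scheme of finite
  type over every COUNTABLE subfield of `k` has a resolution, so does every one over `k` (Löwenheim–Skolem separable
  hull of a finitely generated field of definition, route `Descent`'s `exists_countable_subfield_linearIndepOn_pow`,
  then separable ascent).

What the mechanism does NOT reach is every field that is separable over none of its finitely generated subfields
containing a given finite set — among them EVERY PERFECT FIELD CONTAINING A TRANSCENDENTAL (sibling file
`…PrimeFieldReachNegative.lean`: Mac Lane separability of a perfect `k` over `L` forces `L` perfect), in particular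
the one countable field `Ω₁(p) = (𝔽_p(x₀,x₁,…))^{perf}` on which door 1 is decided (`primeFieldToPerfect_iff_oneField`,
res-L1-s82-pv-1 gen 4). So the reach theorem and the residual of record are complementary BY NAME.

HONEST FRAMING. OURS theorems (role replaced: §17 ¶2 p.89 l.59–62 of [Hironaka2017] «reformulate the resolution
problem» for imperfect / non-prime ground fields, typed AS PRINTED as `S17Methodology.U89_3`); NOT statements of the
manuscript; nothing attributed to its author; no typed candidate used. No new mathematics is claimed: the field
theory and the separable ascent are route `Descent`'s support files (crux stmt-0549), re-keyed here to door 1's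
antecedent. AI work, weaker than expert review; no claim beyond the kernel.
-/

noncomputable section

set_option linter.dupNamespace false -- mandated namespace of this single-conjunct summit

open CategoryTheory CategoryTheory.Limits AlgebraicGeometry TopologicalSpace
open Literature.AlgebraicGeometry.Resolution

namespace Summit.ResolutionOfSingularities.ResolutionOfSingularities.Theorems.CampaignW82

/-! ## §1 REACH: resolution over the finitely generated subfields + separable exhaustion ⇒ resolution over `k` -/

/-- **THE REACH OF LEVEL RESOLUTION.** Let `k` be a field of characteristic `p` such that every reduced separated
scheme of finite type over every finitely generated subfield `L = closure t ⊆ k` has a resolution of singularities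
(`hlev`; under door 1's antecedent this is `Theorems.fgLevelRes_of_primeFieldRes`), and suppose `k` is separably
exhausted by finitely generated subfields (`hsep`: every finite `s ⊆ k` lies in a finitely generated `L` such that
`L`-linearly independent finite families of `k` have `L`-linearly independent `p`-th powers). Then every reduced
separated `k`-scheme of finite type has a resolution: descend `X` to a finitely generated `K₀` (`stub_fgModel`),
resolve over a Mac Lane-separable finitely generated level `L ⊇ K₀` (`stub_robustLevelSeparable` fed by `hlev`),
and ascend (`stub_regularOfFiniteLevels`, `stub_resolutionOfRobustModel`). Verbatim the proof of route `Descent`'s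
`hasResolution_of_perfectRes_of_separablyExhausted` with the level resolution as hypothesis.
[cite: EGAIV2, Prop. 6.7.4] -/
theorem hasResolution_of_fgLevelRes_of_separablyExhausted (p : ℕ) [Fact p.Prime] (k : Type) [Field k]
    [CharP k p]
    (hlev : ∀ (L : Subfield k) (t : Finset k), L = Subfield.closure (↑t : Set k) →
      ∀ (Z : Scheme.{0}) (g : Z ⟶ Spec (.of L)), IsSeparated g → LocallyOfFiniteType g →
        QuasiCompact g → IsReduced Z → Scheme.HasResolution Z)
    (hsep : ∀ s : Finset k, ∃ (L : Subfield k) (t : Finset k), L = Subfield.closure (↑t : Set k) ∧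
      (↑s : Set k) ⊆ L ∧ ∀ u : Finset k, LinearIndepOn L _root_.id (↑u : Set k) →
        LinearIndepOn L (fun x : k => x ^ p) (↑u : Set k))
    (X : Scheme.{0}) (f : X ⟶ Spec (.of k)) [IsSeparated f] [LocallyOfFiniteType f] [QuasiCompact f]
    [IsReduced X] : Scheme.HasResolution X := by
  classical
  -- finitely generated field of definition
  obtain ⟨K₀, s, hK₀, X₀, f₀, h₁, h₂, h₃, h₄, ⟨e⟩⟩ := stub_fgModel k X f ‹_› ‹_› ‹_› ‹_›
  have hredb : IsReduced (pullback f₀ (Spec.map (CommRingCat.ofHom K₀.subtype))) :=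
    isReduced_of_isOpenImmersion e.inv
  -- a separable finitely generated level above it
  obtain ⟨L, t, hLt, hsL, hML⟩ := hsep s
  have hL : K₀ ≤ L := by
    rw [hK₀]
    exact Subfield.closure_le.mpr hsL
  obtain ⟨L₁, hL₁, t₁, hLt₁, Y, π, hπp, hπb, hrob⟩ :=
    stub_robustLevelSeparable p k hlev K₀ s hK₀ X₀ f₀ h₁ h₂ h₃ h₄ hredb ⟨L, hL, t, hLt, hML⟩
  haveI := h₁; haveI := h₂; haveI := h₃; haveI := hπp
  have hreg : Scheme.IsRegular (pullback (π ≫ pullback.snd f₀ (Spec.map (CommRingCat.ofHom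
      (Subfield.inclusion hL₁)))) (Spec.map (CommRingCat.ofHom L₁.subtype))) :=
    stub_regularOfFiniteLevels k L₁ t₁ hLt₁ Y _ inferInstance inferInstance hrob
  exact (stub_resolutionOfRobustModel k K₀ L₁ hL₁ X₀ f₀ h₁ h₂ h₃ Y π hπp hπb hreg).of_iso e.inv

/-- **Separable algebraic over a finitely generated subfield ⇒ reached.** With `hlev` as above, every reduced
separated scheme of finite type over a field `k` separable algebraic over a finitely generated subfield
`L₀ = closure s₀` has a resolution (route `Descent`'s closure property `hasResolution_of_resOver_of_isSeparable`,
fed by `hlev` at `L₀`). Examples: `k` finitely generated; `k = 𝔽_p(t₁,…,tₙ)^{sep}`; `k = 𝔽̄_p(t₁,…,tₙ)`;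
`k` algebraic over `𝔽_p` (`s₀ = ∅`). [cite: EGAIV2, Prop. 6.7.4] -/
theorem hasResolution_of_fgLevelRes_of_isSeparable_fg (p : ℕ) [Fact p.Prime] (k : Type) [Field k] [CharP k p]
    (hlev : ∀ (L : Subfield k) (t : Finset k), L = Subfield.closure (↑t : Set k) →
      ∀ (Z : Scheme.{0}) (g : Z ⟶ Spec (.of L)), IsSeparated g → LocallyOfFiniteType g →
        QuasiCompact g → IsReduced Z → Scheme.HasResolution Z)
    (L₀ : Subfield k) (s₀ : Finset k) (hL₀ : L₀ = Subfield.closure (↑s₀ : Set k)) [Algebra.IsSeparable L₀ k]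
    (X : Scheme.{0}) (f : X ⟶ Spec (.of k)) [IsSeparated f] [LocallyOfFiniteType f] [QuasiCompact f]
    [IsReduced X] : Scheme.HasResolution X :=
  hasResolution_of_resOver_of_isSeparable p k L₀ (hlev L₀ s₀ hL₀) X f

/-! ## §2 Fields with a separating transcendence basis over the PRIME field are separably exhausted by finitely
generated subfields -/

/-- The prime subfield is pointwise fixed by Frobenius: `x ^ p = x` for `x ∈ ⊥`. [folklore] -/
theorem pow_char_eq_self_of_mem_bot {p : ℕ} [Fact p.Prime] {k : Type} [Field k] [CharP k p] {x : k}
    (hx : x ∈ (⊥ : Subfield k)) : x ^ p = x := by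
  have h : (⊥ : Subfield k) ≤ (frobenius k p).eqLocusField (RingHom.id k) := bot_le
  have hx' := h hx
  rw [RingHom.mem_eqLocusField, frobenius_def, RingHom.id_apply] at hx'
  exact hx'

/-- The prime subfield is relatively perfect: every element of `⊥` is the `p`-th power of an element of `⊥`
(namely of itself). [folklore] -/
theorem forall_mem_bot_exists_pow_eq (p : ℕ) [Fact p.Prime] (k : Type) [Field k] [CharP k p] :
    ∀ x ∈ (⊥ : Subfield k), ∃ y ∈ (⊥ : Subfield k), y ^ p = x :=
  fun x hx => ⟨x, hx, pow_char_eq_self_of_mem_bot hx⟩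

/-- Closing up over the prime subfield changes nothing: `closure (⊥ ∪ X) = closure X`. [folklore] -/
theorem closure_bot_union {k : Type} [Field k] (X : Set k) :
    Subfield.closure ((↑(⊥ : Subfield k) : Set k) ∪ X) = Subfield.closure X := by
  rw [Subfield.closure_union, Subfield.closure_eq, bot_sup_eq]

/-- **A separating transcendence basis over the prime field gives separable exhaustion by finitely generated
subfields** (Mac Lane 1939; Matsumura, Commutative Ring Theory, Thm. 26.5–26.8). Let `B ⊆ k` have `p`-independent
finite subfamilies (the reduced monomials in finitely many distinct elements of `B` are `k^p`-linearly independent)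
and let `k` be separable algebraic over `𝔽_p(B) = adjoin ⊥ B`. Then every finite `s ⊆ k` lies in the finitely
generated subfield `L = closure (T ∪ s)` for a finite `T ⊆ B`, and `k / L` is Mac Lane-separable. Route
`Descent`'s `exhaustedByEssFiniteType_of_separatingTranscendenceBasis` run at the perfect subfield `P = ⊥`, keeping
track of the fact that the level `⊥(T)(s)` is the finitely generated field `closure (T ∪ s)`.
[cite: Matsumura1987, §26 Thm. 26.5–26.8] -/
theorem separablyExhausted_of_separatingTranscendenceBasis_bot (p : ℕ) [Fact p.Prime] (k : Type) [Field k]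
    [CharP k p] (B : Set k)
    (hB : ∀ (n : ℕ) (t : Fin n → k), Function.Injective t → Set.range t ⊆ B →
      ∀ e : (Fin n → Fin p) → k, ∑ α, (∏ i, t i ^ (α i : ℕ)) * e α ^ p = 0 → ∀ α, e α = 0)
    [Algebra.IsSeparable (IntermediateField.adjoin (⊥ : Subfield k) B) k] (s : Finset k) :
    ∃ (L : Subfield k) (t : Finset k), L = Subfield.closure (↑t : Set k) ∧ (↑s : Set k) ⊆ L ∧
      ∀ u : Finset k, LinearIndepOn L _root_.id (↑u : Set k) →
        LinearIndepOn L (fun x : k => x ^ p) (↑u : Set k) := by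
  classical
  set P : Subfield k := ⊥ with hPdef
  have hP : ∀ x ∈ P, ∃ y ∈ P, y ^ p = x := forall_mem_bot_exists_pow_eq p k
  -- a finite `T ⊆ B` over which `s` is separable algebraic
  obtain ⟨T, hTB, hTsep⟩ := exists_finset_isSeparable_closure P B s
    fun x _ => Algebra.IsSeparable.isSeparable _ x
  -- enumerate `T`
  set n := T.card with hn
  let t : Fin n → k := fun i => ((T.equivFin.symm i : ↥T) : k)
  have htinj : Function.Injective t := fun a b h =>
    T.equivFin.symm.injective (Subtype.ext h)
  have htrange : Set.range t = ↑T := by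
    ext y
    constructor
    · rintro ⟨i, rfl⟩
      exact (T.equivFin.symm i).2
    · intro hy
      exact ⟨T.equivFin ⟨y, hy⟩, by simp [t]⟩
  have ht := hB n t htinj (htrange ▸ hTB)
  -- the level `F₁ = ⊥(T) = closure T` and Mac Lane for `k / F₁`
  set F₁ := Subfield.closure ((↑P : Set k) ∪ Set.range t) with hF₁
  have hML₁ := linearIndepOn_pow_closure_perfect_range P hP t ht
  have hsep₁ : ∀ x ∈ s, IsSeparable F₁ x := by
    have h := hTsep T le_rfl
    rw [← htrange] at h
    exact h
  -- the level `L = F₁(s)`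
  set L : Subfield k := (IntermediateField.adjoin F₁ (↑s : Set k)).toSubfield with hLdef
  have hF₁L : F₁ ≤ L := fun x hx =>
    (IntermediateField.adjoin F₁ (↑s : Set k)).algebraMap_mem ⟨x, hx⟩
  haveI : Algebra.IsSeparable F₁ (IntermediateField.adjoin F₁ (↑s : Set k)) :=
    (IntermediateField.isSeparable_adjoin_iff_isSeparable F₁ k).mpr fun x hx => hsep₁ x hx
  have hsepL : ∀ y ∈ L, IsSeparable F₁ y := fun y hy =>
    IntermediateField.isSeparable_of_mem_isSeparable F₁ k (L := IntermediateField.adjoin F₁ (↑s : Set k)) hy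
  have hMLL := linearIndepOn_pow_of_isSeparable_tower p F₁ L hF₁L hsepL hML₁
  -- `L` is the finitely generated field `closure (T ∪ s)`
  have hLeq : L = Subfield.closure (↑(T ∪ s) : Set k) := by
    rw [hLdef, IntermediateField.adjoin_toSubfield, Finset.coe_union, ← htrange]
    have hr₁ : Set.range (algebraMap F₁ k) = (↑F₁ : Set k) := by
      ext y; exact ⟨fun ⟨z, hz⟩ => hz ▸ z.2, fun hy => ⟨⟨y, hy⟩, rfl⟩⟩
    rw [hr₁, Subfield.closure_union, Subfield.closure_eq, hF₁, hPdef, closure_bot_union,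
      ← Subfield.closure_union]
  exact ⟨L, T ∪ s, hLeq, fun x hx => IntermediateField.subset_adjoin F₁ _ hx, hMLL⟩

/-- **Resolution over the finitely generated subfields ⇒ resolution over every field with a separating transcendence
basis over the prime field** (any transcendence degree; reduced separated schemes of finite type of any dimension).
Examples: `k = Frac 𝔽_p[x_σ]` for any set of variables `σ`; separable algebraic extensions of it (`𝔽̄_p(x_σ)`,
`𝔽_p(x_σ)^{sep}`). Non-examples (not separably generated over `𝔽_p`): perfect fields of positive transcendence
degree, `𝔽_p((t))`. [cite: Matsumura1987, §26 Thm. 26.5–26.8] -/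
theorem hasResolution_of_fgLevelRes_of_separatingTranscendenceBasis_bot (p : ℕ) [Fact p.Prime] (k : Type)
    [Field k] [CharP k p]
    (hlev : ∀ (L : Subfield k) (t : Finset k), L = Subfield.closure (↑t : Set k) →
      ∀ (Z : Scheme.{0}) (g : Z ⟶ Spec (.of L)), IsSeparated g → LocallyOfFiniteType g →
        QuasiCompact g → IsReduced Z → Scheme.HasResolution Z)
    (B : Set k)
    (hB : ∀ (n : ℕ) (t : Fin n → k), Function.Injective t → Set.range t ⊆ B →
      ∀ e : (Fin n → Fin p) → k, ∑ α, (∏ i, t i ^ (α i : ℕ)) * e α ^ p = 0 → ∀ α, e α = 0)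
    [Algebra.IsSeparable (IntermediateField.adjoin (⊥ : Subfield k) B) k]
    (X : Scheme.{0}) (f : X ⟶ Spec (.of k)) [IsSeparated f] [LocallyOfFiniteType f] [QuasiCompact f]
    [IsReduced X] : Scheme.HasResolution X :=
  hasResolution_of_fgLevelRes_of_separablyExhausted p k hlev
    (separablyExhausted_of_separatingTranscendenceBasis_bot p k B hB) X f

/-! ## §3 Countable ground fields decide -/

/-- **COUNTABLE SUBFIELDS DECIDE.** If every reduced separated scheme of finite type over every COUNTABLE subfield
`K ⊆ k` has a resolution of singularities, then so does every reduced separated scheme of finite type over `k`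
(characteristic `p`): descend `X` to a finitely generated `K₀` (`stub_fgModel`), enlarge `K₀` to a countable
`K ⊆ k` with `k / K` Mac Lane-separable (route `Descent`'s Löwenheim–Skolem hull
`exists_countable_subfield_linearIndepOn_pow`), resolve `X₀ ×_{K₀} K` by hypothesis and ascend along `k / K`
(`hasResolution_pullback_subtype_of_linearIndepOn_pow`). The proof of `descentPerfectToAll_of_countable` with the
countable-level resolution as hypothesis. [cite: Matsumura1987, Thm. 26.4] -/
theorem hasResolution_of_countableLevels (p : ℕ) [Fact p.Prime] (k : Type) [Field k] [CharP k p]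
    (hcount : ∀ (K : Subfield k), (K : Set k).Countable →
      ∀ (Z : Scheme.{0}) (g : Z ⟶ Spec (.of K)), IsSeparated g → LocallyOfFiniteType g →
        QuasiCompact g → IsReduced Z → Scheme.HasResolution Z)
    (X : Scheme.{0}) (f : X ⟶ Spec (.of k)) [IsSeparated f] [LocallyOfFiniteType f] [QuasiCompact f]
    [IsReduced X] : Scheme.HasResolution X := by
  classical
  have hp : p.Prime := Fact.out
  -- finitely generated field of definition
  obtain ⟨K₀, s, hK₀, X₀, f₀, h₁, h₂, h₃, h₄, ⟨e⟩⟩ := stub_fgModel k X f ‹_› ‹_› ‹_› ‹_›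
  haveI := h₁; haveI := h₂; haveI := h₃; haveI := h₄
  haveI : IsReduced (pullback f₀ (Spec.map (CommRingCat.ofHom K₀.subtype))) :=
    isReduced_of_isOpenImmersion e.inv
  -- a countable separable hull `K ⊇ K₀`
  obtain ⟨K, hsK, hKc, hML⟩ := exists_countable_subfield_linearIndepOn_pow p s
  have hK₀K : K₀ ≤ K := by
    rw [hK₀, Subfield.closure_le]
    exact hsK
  -- resolve the countable level
  set ι₁ := Spec.map (CommRingCat.ofHom (Subfield.inclusion hK₀K)) with hι₁
  haveI : IsReduced (pullback f₀ ι₁) := isReduced_pullback_inclusion K₀ K hK₀K f₀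
  have hresK : Scheme.HasResolution (pullback f₀ ι₁) :=
    hcount K hKc _ (pullback.snd f₀ ι₁) inferInstance inferInstance inferInstance inferInstance
  -- ascend along the separable extension `k / K`
  haveI : ExpChar k p := ExpChar.prime hp
  have hk := hasResolution_pullback_subtype_of_linearIndepOn_pow p hp K hML (pullback.snd f₀ ι₁) hresK
  have hcomp : K.subtype.comp (Subfield.inclusion hK₀K) = K₀.subtype := RingHom.ext fun _ => rfl
  have ecomp : Spec.map (CommRingCat.ofHom K.subtype) ≫ ι₁ =
      Spec.map (CommRingCat.ofHom K₀.subtype) := by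
    rw [hι₁, ← Spec.map_comp, ← CommRingCat.ofHom_comp, hcomp]
  exact (hk.of_iso (pullbackLeftPullbackSndIso f₀ ι₁ (Spec.map (CommRingCat.ofHom K.subtype)) ≪≫
    pullback.congrHom rfl ecomp).hom).of_iso e.inv

end Summit.ResolutionOfSingularities.ResolutionOfSingularities.Theorems.CampaignW82

end
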